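import Summits.CriticalPhenomena.PercolationContinuityZ3.Theorems.PercNearOneGluingNoHeavyLowerTailCovTauTransfer
import HarnessLib

/-!
# The two-cluster EXCHANGE INEQUALITY behind Kozma–Nitzan's Question 9 for two relays

Support file (`--supports stmt-CriticalPhenomena-4575`), prover `prim-ineq-gen-6` (gen 11; memo `prim-ineq-gen-6/FINDING-G11.md` §2g).
No definitions, no named facts, no sorries; standard axioms.

THEOREM (`KNQ9.twoCluster_exchange`).  Finite weighted graph, `μ = prodBernoulli w`, vertices `k ≠ c`, `b`, a vertex set `B`;
`D = {k ↮ c}`, `H_k = {C(k) meets B}`, `M_c = {C(c) misses B}`, `Z = μ(D ∩ H_k ∩ M_c)`.  Then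

  `μ(D) · [ μ(D ∩ H_k ∩ M_c ∩ {k ↔ b}) − μ(D ∩ H_k ∩ M_c ∩ {c ↔ b}) ]  ≥  Z · [ μ(D ∩ {k ↔ b}) − μ(D ∩ {c ↔ b}) ]`.

Why it matters: if a new vertex `0` is joined to the graph by independent edges, then given the old configuration the events
"`0` reaches `C(k)` but not `C(c)`" have exactly the product form `H_k ∩ M_c` (with `B` the random set of open neighbours of
`0`), so summing the theorem over the stars of `0` gives, for `A = {c, k}`,
`P(0↔b, 0↔A) − P(0↔A, c↔b) ≥ (P_H(k↔b) − P_H(c↔b)) · P(0↔k, 0↮c) / P_H(k↮c)`  (`H` = the graph without `0`), i.e.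
Kozma–Nitzan's QUESTION 9 (arXiv:2401.12397 p. 36) for `|A| = 2`: the relay minimising `P_H(· ↔ b)` satisfies their (41) —
file `…KNQuestion9Pair`.

PROOF (van den Berg–Häggström–Kahn).  By the tower property along `σ(C_k)` inside `D` (vdBHK Lemma 2.4, tree
`CovTau.tower_clusterFun`), `μ(D ∩ {C_k ∈ 𝒮} ∩ M_c) = ∫_{D ∩ {C_k ∈ 𝒮}} g(C_k)` with `g(K) = P(C(c) misses B in G ∖ K̄)`, an
INCREASING function of the edge cluster `K`; so with `F₁ = 1{K meets B}·g(K)` (increasing) and `G₂ = 1{b ∈ V(K)}` (increasing),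
vdBHK Thm 1.3 given `D` (`BHK2006_clusterConditionalPositiveAssociation_holds`) gives `μ(D)·μ(D∩H_k∩M_c∩{k↔b}) ≥ Z·μ(D∩{k↔b})`.
Symmetrically along `σ(C_c)`: `h(K') = P(C(k) meets B in G ∖ K̄')` is DECREASING, `1{K' misses B}·h` is decreasing and
`1{b ∈ V(K')}` increasing, so the reversed inequality gives `μ(D)·μ(D∩H_k∩M_c∩{c↔b}) ≤ Z·μ(D∩{c↔b})`.  Subtract.
[cite: VandenbergHaggstromKahn2005, Thm. 1.3 (p. 6), §2.1 Lemma 2.4 (p. 10)] [cite: KozmaNitzan2024, Question 9 (p. 36), Thm. 1 (pp. 7–8)]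
-/

noncomputable section

namespace Summit.CriticalPhenomena.PercolationContinuityZ3.Theorems

open MeasureTheory Set Literature.Probability.LatticeModels Literature.Probability.Percolation
open scoped Classical
open KNPreFKG BHK2006

namespace KNQ9

variable {V : Type*} [Fintype V]

/-- **The two-cluster exchange inequality** (see the file header): with `D = {k ↮ c}`, `H_k = {C(k) meets B}`,
`M_c = {C(c) misses B}`,
`μ(D)·[μ(D ∩ (H_k ∩ M_c) ∩ {k↔b}) − μ(D ∩ (H_k ∩ M_c) ∩ {c↔b})] ≥ μ(D ∩ (H_k ∩ M_c))·[μ(D ∩ {k↔b}) − μ(D ∩ {c↔b})]`.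
Two applications of vdBHK Thm 1.3 given `D` after projecting on `σ(C_k)`, resp. `σ(C_c)` (vdBHK Lemma 2.4).
[cite: VandenbergHaggstromKahn2005, Thm. 1.3 (p. 6), §2.1 Lemma 2.4 (p. 10)] [cite: KozmaNitzan2024, Question 9 (p. 36)] -/
theorem twoCluster_exchange (w : Sym2 V → unitInterval) (k c b : V) (hkc : k ≠ c) (B : Set V) :
    (prodBernoulli w).real ({ω : BondConfig V | ¬ (openGraph ω).Reachable k c} ∩
          ({ω | ∃ u ∈ B, (openGraph ω).Reachable k u} ∩ {ω | ∀ u ∈ B, ¬ (openGraph ω).Reachable c u})) *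
        ((prodBernoulli w).real ({ω : BondConfig V | ¬ (openGraph ω).Reachable k c} ∩ openConn k b) -
          (prodBernoulli w).real ({ω : BondConfig V | ¬ (openGraph ω).Reachable k c} ∩ openConn c b)) ≤
      (prodBernoulli w).real {ω : BondConfig V | ¬ (openGraph ω).Reachable k c} *
        ((prodBernoulli w).real ({ω : BondConfig V | ¬ (openGraph ω).Reachable k c} ∩
            ({ω | ∃ u ∈ B, (openGraph ω).Reachable k u} ∩ {ω | ∀ u ∈ B, ¬ (openGraph ω).Reachable c u}) ∩
              openConn k b) -
          (prodBernoulli w).real ({ω : BondConfig V | ¬ (openGraph ω).Reachable k c} ∩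
            ({ω | ∃ u ∈ B, (openGraph ω).Reachable k u} ∩ {ω | ∀ u ∈ B, ¬ (openGraph ω).Reachable c u}) ∩
              openConn c b)) := by
  classical
  set μ := prodBernoulli w with hμ
  haveI : IsProbabilityMeasure μ := by rw [hμ]; infer_instance
  have hmeas : ∀ S : Set (BondConfig V), MeasurableSet S := fun _ => MeasurableSet.of_discrete
  -- events
  set D : Set (BondConfig V) := {ω | ¬ (openGraph ω).Reachable k c} with hD
  set Hk : Set (BondConfig V) := {ω | ∃ u ∈ B, (openGraph ω).Reachable k u} with hHk
  set Mc : Set (BondConfig V) := {ω | ∀ u ∈ B, ¬ (openGraph ω).Reachable c u} with hMc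
  -- the same events through the edge clusters
  set 𝒽 : Set (Set (Sym2 V)) := {K | ∃ u ∈ B, u = k ∨ ∃ e ∈ K, u ∈ e} with h𝒽
  set ℳ : Set (Set (Sym2 V)) := disconnFamily c B with hℳ
  have hHk' : {ω : BondConfig V | openEdgeCluster ω k ∈ 𝒽} = Hk := by
    ext ω
    simp only [mem_setOf_eq, h𝒽, hHk]
    refine exists_congr fun u => and_congr_right fun _ => ?_
    rw [reachable_iff_exists_mem_openEdgeCluster]
  have hMc' : {ω : BondConfig V | openEdgeCluster ω c ∈ ℳ} = Mc := by
    rw [hℳ, hMc, ← setOf_forall_not_reachable_eq]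
  have hKb : {ω : BondConfig V | openEdgeCluster ω k ∈ connFamily k b} = openConn k b :=
    (openConn_eq_setOf_connFamily k b).symm
  have hCb : {ω : BondConfig V | openEdgeCluster ω c ∈ connFamily c b} = openConn c b :=
    (openConn_eq_setOf_connFamily c b).symm
  -- `D` in the BHK / tower shapes
  have hDk : {ω : BondConfig V | ∀ x ∈ ({c} : Set V), ¬ (openGraph ω).Reachable k x} = D := by
    ext ω; simp [hD]
  have hDc : {ω : BondConfig V | ∀ x ∈ ({k} : Set V), ¬ (openGraph ω).Reachable c x} = D := by
    ext ω
    simp only [mem_singleton_iff, forall_eq, mem_setOf_eq, hD]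
    exact ⟨fun h h' => h h'.symm, fun h h' => h h'.symm⟩
  have hDc' : {ω : BondConfig V | ¬ (openGraph ω).Reachable c k} = D := by
    ext ω
    simp only [mem_setOf_eq, hD]
    exact ⟨fun h h' => h h'.symm, fun h h' => h h'.symm⟩
  -- the vertex-set functionals "misses B" / "meets B"
  set Fmiss : Set V → ℝ := fun S => if ∀ u ∈ B, u ∉ S then 1 else 0 with hFmiss
  set Fmeet : Set V → ℝ := fun S => if ∃ u ∈ B, u ∈ S then 1 else 0 with hFmeet
  have hFmiss_anti : ∀ S T : Set V, S ⊆ T → Fmiss T ≤ Fmiss S := by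
    intro S T hST
    by_cases hT : ∀ u ∈ B, u ∉ T
    · have hS : ∀ u ∈ B, u ∉ S := fun u hu h => hT u hu (hST h)
      simp only [hFmiss]
      rw [if_pos hT, if_pos hS]
    · simp only [hFmiss]
      rw [if_neg hT]
      split_ifs <;> norm_num
  have hFmeet_mono : ∀ S T : Set V, S ⊆ T → Fmeet S ≤ Fmeet T := by
    intro S T hST
    by_cases hS : ∃ u ∈ B, u ∈ S
    · have hT : ∃ u ∈ B, u ∈ T := by
        obtain ⟨u, hu, huS⟩ := hS
        exact ⟨u, hu, hST huS⟩
      simp only [hFmeet]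
      rw [if_pos hS, if_pos hT]
    · simp only [hFmeet]
      rw [if_neg hS]
      split_ifs <;> norm_num
  have hFmiss_c : (fun ω : BondConfig V => Fmiss (openCluster ω c)) = Mc.indicator 1 := by
    funext ω
    by_cases hω : ω ∈ Mc
    · rw [indicator_of_mem hω, Pi.one_apply]
      exact if_pos fun u hu h => hω u hu h
    · rw [indicator_of_notMem hω]
      exact if_neg fun h => hω fun u hu hr => h u hu hr
  have hFmeet_k : (fun ω : BondConfig V => Fmeet (openCluster ω k)) = Hk.indicator 1 := by
    funext ω
    by_cases hω : ω ∈ Hk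
    · rw [indicator_of_mem hω, Pi.one_apply]
      obtain ⟨u, hu, hr⟩ := hω
      exact if_pos ⟨u, hu, hr⟩
    · rw [indicator_of_notMem hω]
      exact if_neg fun ⟨u, hu, hr⟩ => hω ⟨u, hu, hr⟩
  -- the conditional means along `σ(C_k)` and `σ(C_c)`
  set gB : Set (Sym2 V) → ℝ := fun K => ∫ η, Fmiss (openCluster (η \ barOf {k} K) c) ∂μ with hgB
  set hB : Set (Sym2 V) → ℝ := fun K => ∫ η, Fmeet (openCluster (η \ barOf {c} K) k) ∂μ with hhB
  have hgB_mono : Monotone gB := by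
    intro K K' hKK'
    refine integral_mono Integrable.of_finite Integrable.of_finite fun η => ?_
    have hsub : η \ barOf {k} K' ⊆ η \ barOf {k} K := fun e he => ⟨he.1, fun h' => he.2 (barOf_mono {k} hKK' h')⟩
    exact hFmiss_anti _ _ (openCluster_mono hsub c)
  have hhB_anti : Antitone hB := CovTau.antitone_condMean w k c Fmeet hFmeet_mono
  have hgB_nonneg : ∀ K, 0 ≤ gB K := fun K => integral_nonneg fun η => by
    simp only [hFmiss]; split_ifs <;> norm_num
  have hhB_nonneg : ∀ K, 0 ≤ hB K := fun K => integral_nonneg fun η => by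
    simp only [hFmeet]; split_ifs <;> norm_num
  -- the functionals fed to vdBHK
  set F1 : Set (Sym2 V) → ℝ := fun K => 𝒽.indicator (1 : Set (Sym2 V) → ℝ) K * gB K with hF1
  set G2 : Set (Sym2 V) → ℝ := (connFamily k b).indicator 1 with hG2
  set F1' : Set (Sym2 V) → ℝ := fun K => ℳ.indicator (1 : Set (Sym2 V) → ℝ) K * hB K with hF1'
  set G2' : Set (Sym2 V) → ℝ := (connFamily c b).indicator 1 with hG2'
  have h𝒽_up : IsUpperSet 𝒽 := by
    rintro K K' hKK' ⟨u, hu, h⟩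
    rcases h with h | ⟨e, he, hue⟩
    · exact ⟨u, hu, Or.inl h⟩
    · exact ⟨u, hu, Or.inr ⟨e, hKK' he, hue⟩⟩
  have hF1_mono : Monotone F1 := by
    intro K K' hKK'
    simp only [hF1]
    by_cases hK : K ∈ 𝒽
    · rw [indicator_of_mem hK, indicator_of_mem (h𝒽_up hKK' hK)]
      simp only [Pi.one_apply, one_mul]
      exact hgB_mono hKK'
    · rw [indicator_of_notMem hK, zero_mul]
      exact mul_nonneg (indicator_nonneg (fun _ _ => zero_le_one) _) (hgB_nonneg K')
  have hG2_mono : Monotone G2 := monotone_indicator_one_of_isUpperSet (isUpperSet_connFamily k b)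
  have hF1'_anti : Antitone F1' := by
    intro K K' hKK'
    simp only [hF1']
    by_cases hK' : K' ∈ ℳ
    · rw [indicator_of_mem hK', indicator_of_mem (isLowerSet_disconnFamily c B hKK' hK')]
      simp only [Pi.one_apply, one_mul]
      exact hhB_anti hKK'
    · rw [indicator_of_notMem hK', zero_mul]
      exact mul_nonneg (indicator_nonneg (fun _ _ => zero_le_one) _) (hhB_nonneg K)
  have hG2'_mono : Monotone G2' := monotone_indicator_one_of_isUpperSet (isUpperSet_connFamily c b)
  -- reading the integrals: owner `k`
  have towK : ∀ 𝒮 : Set (Set (Sym2 V)),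
      ∫ ω in D ∩ {ω | openEdgeCluster ω k ∈ 𝒮}, gB (openEdgeCluster ω k) ∂μ =
        μ.real (D ∩ {ω | openEdgeCluster ω k ∈ 𝒮} ∩ Mc) := by
    intro 𝒮
    have t := CovTau.tower_clusterFun w c k Fmiss 𝒮
    rw [hD]
    rw [← t, show (fun ω : BondConfig V => Fmiss (openCluster ω c)) = Mc.indicator 1 from hFmiss_c,
      setIntegral_indicator_one_eq]
  have intF1 : ∫ ω in D, F1 (openEdgeCluster ω k) ∂μ = μ.real (D ∩ (Hk ∩ Mc)) := by
    have e : ∀ ω : BondConfig V, F1 (openEdgeCluster ω k) =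
        gB (openEdgeCluster ω k) * {ω : BondConfig V | openEdgeCluster ω k ∈ 𝒽}.indicator (1 : BondConfig V → ℝ) ω := by
      intro ω
      simp only [hF1]
      rw [mul_comm]
      exact congrArg (fun t => gB (openEdgeCluster ω k) * t) (congrFun (indicator_comp_openEdgeCluster 𝒽 k) ω)
    simp_rw [e]
    rw [setIntegral_mul_indicator_one, towK 𝒽, hHk', inter_assoc]
  have intF1G2 : ∫ ω in D, F1 (openEdgeCluster ω k) * G2 (openEdgeCluster ω k) ∂μ =
      μ.real (D ∩ (Hk ∩ Mc) ∩ openConn k b) := by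
    have e : ∀ ω : BondConfig V, F1 (openEdgeCluster ω k) * G2 (openEdgeCluster ω k) =
        gB (openEdgeCluster ω k) *
          {ω : BondConfig V | openEdgeCluster ω k ∈ 𝒽 ∩ connFamily k b}.indicator (1 : BondConfig V → ℝ) ω := by
      intro ω
      simp only [hF1, hG2]
      have i1 := congrFun (indicator_comp_openEdgeCluster 𝒽 k) ω
      have i2 := congrFun (indicator_comp_openEdgeCluster (connFamily k b) k) ω
      rw [i1, i2]
      have hAB : {ω : BondConfig V | openEdgeCluster ω k ∈ 𝒽 ∩ connFamily k b} =
          {ω : BondConfig V | openEdgeCluster ω k ∈ 𝒽} ∩ {ω | openEdgeCluster ω k ∈ connFamily k b} := by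
        ext ω'; simp only [mem_inter_iff, mem_setOf_eq]
      rw [hAB, ← congrFun (indicator_one_mul_indicator_one _ _) ω]
      ring
    simp_rw [e]
    rw [setIntegral_mul_indicator_one, towK (𝒽 ∩ connFamily k b)]
    have : {ω : BondConfig V | openEdgeCluster ω k ∈ 𝒽 ∩ connFamily k b} = Hk ∩ openConn k b := by
      rw [← hHk', ← hKb]; ext ω'; simp only [mem_inter_iff, mem_setOf_eq]
    rw [this]
    congr 1
    ext ω'
    simp only [mem_inter_iff]
    tauto
  have intG2 : ∫ ω in D, G2 (openEdgeCluster ω k) ∂μ = μ.real (D ∩ openConn k b) := by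
    simp only [hG2]
    rw [show (fun ω : BondConfig V => (connFamily k b).indicator (1 : Set (Sym2 V) → ℝ) (openEdgeCluster ω k)) =
      (openConn k b : Set (BondConfig V)).indicator 1 from by rw [indicator_comp_openEdgeCluster, hKb],
      setIntegral_indicator_one_eq]
  -- reading the integrals: owner `c`
  have towC : ∀ 𝒮 : Set (Set (Sym2 V)),
      ∫ ω in D ∩ {ω | openEdgeCluster ω c ∈ 𝒮}, hB (openEdgeCluster ω c) ∂μ =
        μ.real (D ∩ {ω | openEdgeCluster ω c ∈ 𝒮} ∩ Hk) := by
    intro 𝒮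
    have t := CovTau.tower_clusterFun w k c Fmeet 𝒮
    rw [hDc'] at t
    rw [← t, show (fun ω : BondConfig V => Fmeet (openCluster ω k)) = Hk.indicator 1 from hFmeet_k,
      setIntegral_indicator_one_eq]
  have intF1' : ∫ ω in D, F1' (openEdgeCluster ω c) ∂μ = μ.real (D ∩ (Hk ∩ Mc)) := by
    have e : ∀ ω : BondConfig V, F1' (openEdgeCluster ω c) =
        hB (openEdgeCluster ω c) * {ω : BondConfig V | openEdgeCluster ω c ∈ ℳ}.indicator (1 : BondConfig V → ℝ) ω := by
      intro ω
      simp only [hF1']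
      rw [mul_comm]
      exact congrArg (fun t => hB (openEdgeCluster ω c) * t) (congrFun (indicator_comp_openEdgeCluster ℳ c) ω)
    simp_rw [e]
    rw [setIntegral_mul_indicator_one, towC ℳ, hMc', inter_assoc, inter_comm Mc Hk]
  have intF1'G2' : ∫ ω in D, G2' (openEdgeCluster ω c) * F1' (openEdgeCluster ω c) ∂μ =
      μ.real (D ∩ (Hk ∩ Mc) ∩ openConn c b) := by
    have e : ∀ ω : BondConfig V, G2' (openEdgeCluster ω c) * F1' (openEdgeCluster ω c) =
        hB (openEdgeCluster ω c) *
          {ω : BondConfig V | openEdgeCluster ω c ∈ ℳ ∩ connFamily c b}.indicator (1 : BondConfig V → ℝ) ω := by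
      intro ω
      simp only [hF1', hG2']
      have i1 := congrFun (indicator_comp_openEdgeCluster ℳ c) ω
      have i2 := congrFun (indicator_comp_openEdgeCluster (connFamily c b) c) ω
      rw [i1, i2]
      have hAB : {ω : BondConfig V | openEdgeCluster ω c ∈ ℳ ∩ connFamily c b} =
          {ω : BondConfig V | openEdgeCluster ω c ∈ ℳ} ∩ {ω | openEdgeCluster ω c ∈ connFamily c b} := by
        ext ω'; simp only [mem_inter_iff, mem_setOf_eq]
      rw [hAB, ← congrFun (indicator_one_mul_indicator_one _ _) ω]
      ring
    simp_rw [e]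
    rw [setIntegral_mul_indicator_one, towC (ℳ ∩ connFamily c b)]
    have : {ω : BondConfig V | openEdgeCluster ω c ∈ ℳ ∩ connFamily c b} = Mc ∩ openConn c b := by
      rw [← hMc', ← hCb]; ext ω'; simp only [mem_inter_iff, mem_setOf_eq]
    rw [this]
    congr 1
    ext ω'
    simp only [mem_inter_iff]
    tauto
  have intG2' : ∫ ω in D, G2' (openEdgeCluster ω c) ∂μ = μ.real (D ∩ openConn c b) := by
    simp only [hG2']
    rw [show (fun ω : BondConfig V => (connFamily c b).indicator (1 : Set (Sym2 V) → ℝ) (openEdgeCluster ω c)) =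
      (openConn c b : Set (BondConfig V)).indicator 1 from by rw [indicator_comp_openEdgeCluster, hCb],
      setIntegral_indicator_one_eq]
  -- vdBHK Thm 1.3 given `D`, owner `k` (increasing × increasing)
  have hkX : k ∉ ({c} : Set V) := by simpa using hkc
  have hcX : c ∉ ({k} : Set V) := by simpa using hkc.symm
  have PA1 := BHK2006_clusterConditionalPositiveAssociation_holds V w k ({c} : Set V) F1 G2 hF1_mono hG2_mono hkX
  rw [hDk, intF1, intG2, intF1G2] at PA1
  -- vdBHK Thm 1.3 given `D`, owner `c` (increasing × decreasing)
  have PA2 := BHK2006_clusterConditionalPositiveAssociation.antitone_right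
    BHK2006_clusterConditionalPositiveAssociation_holds V w c ({k} : Set V) G2' F1' hG2'_mono hF1'_anti hcX
  rw [hDc, intF1'G2', intG2', intF1'] at PA2
  -- assemble
  have e1 : μ.real (D ∩ (Hk ∩ Mc)) * (μ.real (D ∩ openConn k b) - μ.real (D ∩ openConn c b)) =
      μ.real (D ∩ (Hk ∩ Mc)) * μ.real (D ∩ openConn k b) - μ.real (D ∩ openConn c b) * μ.real (D ∩ (Hk ∩ Mc)) := by
    ring
  rw [e1, mul_sub]
  linarith [PA1, PA2]

end KNQ9

end Summit.CriticalPhenomena.PercolationContinuityZ3.Theorems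

end
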